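import Summits.Ventures.HodgeRepro2.A2PontryaginLefschetz
import Summits.Ventures.HodgeRepro2.A2LiebermanModel

/-!
# `Λ^m L^m` is the scalar `(m!)²` on the Weil projection (A2 annex, operator identity — part 7)

Row 104 proved `p_W(z ⋆ θ^k) = (n−k)!·k!·(∏ c_p)·vol • p_W(y'')` for the Lieberman class
`y'' = (L^{n−k})⁻¹ z`; row 109 (`A2PontryaginLefschetz`) proved `z ⋆ θ^k = κ' • Λ^{n−k} z` with
`κ' = k!·(∏ c_p)·vol/(n−k)!`.  The two cohere because the Weil projection of `Λ^m L^m y` is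
`(m!)² p_W(y)` (`weilProjModel_lam_pow_theta_pow_mul`): the monomials
`u = E_{univ∖P₀} ∧ w_{P₀,s}` dual to the Weil coordinates satisfy `θ^m ∧ Λ^m u = (m!)² u`
(`theta_pow_mul_lam_pow_ET_mul_weil`: `Λ^m` removes the `m` full planes, `θ^m` puts them back),
and `Λ` is self-adjoint (`A2LamAdjoint`).  Row 104's identity is then re-derived from row 109
(`weilProjModel_pontryagin_eq_smul'`), with `κ'·((m)!)² = (n−k)!·k!·(∏ c_p)·vol`.
-/

namespace Summit.Ventures.HodgeRepro2.A2LefschetzWeilProjection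

open WeilPlanes WeilIntegral WeilDetect WeilCoproduct A2PlaneMonomials A2LamPowers A2LamAdjoint
  A2HardLefschetzOps A2HardLefschetzMain A2PontryaginModel A2WeilProjection A2ModelDuality
  A2LiebermanModel A2PontryaginLefschetz

variable {ι : Type*} [DecidableEq ι] [Fintype ι]

omit [Fintype ι] in
/-- A plane-sorted monomial whose planes `S` all carry `E_p` is `E_S` times the monomial with those
factors removed. -/
theorem planeProd_eq_ET_mul {L : List ι} (hL : L.Nodup) {m : ι → Bool × Bool} {S : Finset ι}
    (hS : ∀ p ∈ S, p ∈ L ∧ m p = (true, true)) :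
    planeProd L m = ET S * planeProd L (eraseS m S) := by
  induction S using Finset.induction_on with
  | empty => simp
  | insert p S hp ih =>
    have hS' : ∀ q ∈ S, q ∈ L ∧ m q = (true, true) := fun q hq => hS q (Finset.mem_insert_of_mem hq)
    have hpL := hS p (Finset.mem_insert_self p S)
    rw [ih hS', planeProd_eq_E_mul hL hpL.1 (m := eraseS m S)
      (by rw [eraseS_apply_of_notMem m hp]; exact hpL.2), ← eraseS_insert, ET_insert hp,
      mul_assoc, ← mul_assoc (ET S), ← (commute_E p (ET S)).eq, mul_assoc]

/-- The generator list of the monomial `E_{univ ∖ P₀} ∧ w_{P₀,s}`. -/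
noncomputable def weilGenList (P₀ : Finset ι) (s : Bool) : List (Gen ι) :=
  planeList (Finset.univ \ P₀) ++ weilList P₀ s

/-- `E_{univ ∖ P₀} ∧ w_{P₀,s}` is the monomial of `weilGenList`. -/
lemma ET_mul_weil_eq_mono (P₀ : Finset ι) (s : Bool) :
    ET (Finset.univ \ P₀) * weil P₀ s = mono (weilGenList P₀ s) := by
  rw [weilGenList, mono_append, ET_eq_mono]
  rfl

/-- `weilGenList` has no repetition. -/
lemma nodup_weilGenList (P₀ : Finset ι) (s : Bool) : (weilGenList P₀ s).Nodup := by
  rw [weilGenList, List.nodup_append]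
  refine ⟨nodup_planeList _, nodup_weilList _ _, fun a ha b hb hab => ?_⟩
  have ha' := mem_planeList.1 ha
  have hb' := (mem_weilList.1 hb).1
  rw [hab, Finset.mem_sdiff] at ha'
  exact ha'.2 hb'

/-- Membership in `weilGenList`. -/
lemma mem_weilGenList {P₀ : Finset ι} {s : Bool} {j : Gen ι} :
    j ∈ weilGenList P₀ s ↔ (j.1 ∉ P₀) ∨ (j.1 ∈ P₀ ∧ j.2 = s) := by
  rw [weilGenList, List.mem_append, mem_planeList, mem_weilList, Finset.mem_sdiff]
  simp

/-- A plane of `P₀` does not carry `E_p` in `E_{univ ∖ P₀} ∧ w_{P₀,s}`. -/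
lemma ind_weilGenList_of_mem {P₀ : Finset ι} {s : Bool} {p : ι} (hp : p ∈ P₀) :
    ind (weilGenList P₀ s) p ≠ (true, true) := by
  intro h
  have h1 : (p, false) ∈ weilGenList P₀ s := by
    have := congrArg Prod.fst h; simpa [ind] using this
  have h2 : (p, true) ∈ weilGenList P₀ s := by
    have := congrArg Prod.snd h; simpa [ind] using this
  rw [mem_weilGenList] at h1 h2
  simp only [hp, not_true_eq_false, true_and, false_or] at h1 h2
  rw [← h1] at h2
  exact absurd h2 (by decide)

/-- A plane outside `P₀` carries `E_p` in `E_{univ ∖ P₀} ∧ w_{P₀,s}`. -/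
lemma ind_weilGenList_of_notMem {P₀ : Finset ι} {s : Bool} {p : ι} (hp : p ∉ P₀) :
    ind (weilGenList P₀ s) p = (true, true) := by
  simp [ind, mem_weilGenList, hp]

/-- The generator `(p, s)`, `p ∈ P₀`, occurs in the plane-sorted monomial of `weilGenList` with
the planes outside `P₀` removed. -/
lemma mem_flat_eraseS {P₀ : Finset ι} {s : Bool} {p : ι} (hp : p ∈ P₀) :
    (p, s) ∈ flat Finset.univ.toList (eraseS (ind (weilGenList P₀ s)) (Finset.univ \ P₀)) := by
  rw [mem_flat]
  refine ⟨Finset.mem_toList.2 (Finset.mem_univ p), ?_⟩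
  rw [eraseS_apply_of_notMem _ (by simp [hp]), mem_pl]
  have hmem : (p, s) ∈ weilGenList P₀ s := mem_weilGenList.2 (Or.inr ⟨hp, rfl⟩)
  cases s
  · left; exact ⟨rfl, by simpa [ind] using hmem⟩
  · right; exact ⟨rfl, by simpa [ind] using hmem⟩

/-- **`θ^m ∧ Λ^m` is the scalar `(m!)²`** on the monomials `E_{univ ∖ P₀} ∧ w_{P₀,s}`,
`m = |univ ∖ P₀|`: `Λ^m` removes the `m` full planes and `θ^m` puts them back. -/
theorem theta_pow_mul_lam_pow_ET_mul_weil {c : ι → ℂ} (hc : ∀ p, c p ≠ 0) (P₀ : Finset ι)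
    (s : Bool) :
    theta c ^ (Finset.univ \ P₀).card *
        (lam c ^ (Finset.univ \ P₀).card) (ET (Finset.univ \ P₀) * weil P₀ s) =
      (((Finset.univ \ P₀).card.factorial : ℂ) ^ 2) • (ET (Finset.univ \ P₀) * weil P₀ s) := by
  set U := Finset.univ \ P₀ with hU
  set l := weilGenList P₀ s with hl
  obtain ⟨ε, -, hP⟩ := exists_sign_planeProd (nodup_weilGenList P₀ s)
  rw [ET_mul_weil_eq_mono, hP, map_smul, mul_smul_comm, smul_comm]
  congr 1
  set L : List ι := Finset.univ.toList with hL
  set m := ind l with hm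
  -- `Λ^m P = m! • c_E⁻¹ • P∖E`
  have hlam : (lam c ^ U.card) (planeProd L m) =
      (U.card.factorial : ℂ) • ((∏ p ∈ U, (c p)⁻¹) • planeProd L (eraseS m U)) := by
    rw [lam_pow_planeProd c U.card (Finset.nodup_toList _)]
    congr 1
    rw [Finset.sum_eq_single U]
    · rw [if_pos]
      intro p hp
      refine ⟨Finset.mem_toList.2 (Finset.mem_univ p), ?_⟩
      rw [hm, hl]
      exact ind_weilGenList_of_notMem (Finset.mem_sdiff.1 hp).2
    · intro T hT hTE
      rw [if_neg]
      intro h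
      apply hTE
      refine Finset.eq_of_subset_of_card_le (fun p hp => ?_) ?_
      · rw [hU, Finset.mem_sdiff]
        refine ⟨Finset.mem_univ p, fun hpP => ?_⟩
        exact ind_weilGenList_of_mem hpP (h p hp).2
      · rw [(Finset.mem_powersetCard.1 hT).2]
    · intro h
      exact absurd (Finset.mem_powersetCard.2 ⟨Finset.subset_univ U, rfl⟩) h
  -- `θ^m ∧ (P∖E) = m! c_E • E_E ∧ (P∖E) = m! c_E • P`
  have hw : ∀ p ∈ P₀, E p * planeProd L (eraseS m U) = 0 := by
    intro p hp
    rw [planeProd_eq_mono]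
    exact E_mul_mono_of_mem (mem_flat_eraseS hp)
  have hθ : theta c ^ U.card * planeProd L (eraseS m U) =
      ((U.card.factorial : ℂ) * ∏ p ∈ U, c p) • planeProd L m := by
    rw [theta_pow_card_mul c P₀ _ hw]
    congr 1
    symm
    apply planeProd_eq_ET_mul (Finset.nodup_toList _)
    intro p hp
    refine ⟨Finset.mem_toList.2 (Finset.mem_univ p), ?_⟩
    rw [hm, hl]
    exact ind_weilGenList_of_notMem (Finset.mem_sdiff.1 hp).2
  have hcE : ∏ p ∈ U, c p ≠ 0 := Finset.prod_ne_zero_iff.2 fun p _ => hc p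
  rw [hlam, mul_smul_comm, mul_smul_comm, hθ, smul_smul, smul_smul, Finset.prod_inv_distrib]
  congr 1
  field_simp

/-- `L^m y = θ^m ∧ y`. -/
lemma lef_pow_apply (c : ι → ℂ) (m : ℕ) (y : A ι) : (lef c ^ m) y = theta c ^ m * y := by
  induction m with
  | zero => simp
  | succ m ih => rw [pow_succ', Module.End.mul_apply, ih, lef, LinearMap.mulLeft_apply, pow_succ',
      mul_assoc]

/-- **The Weil coordinates of `Λ^m L^m y` are `(m!)²` times those of `y`**: pairing against
`E_{univ ∖ P₀} ∧ w_{P₀,s}`, `m = |univ ∖ P₀|`. -/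
theorem integral_lam_pow_theta_pow_mul_mul {c : ι → ℂ} (hc : ∀ p, c p ≠ 0) (P₀ : Finset ι)
    (s : Bool) (y : A ι) :
    integral ((lam c ^ (Finset.univ \ P₀).card) (theta c ^ (Finset.univ \ P₀).card * y) *
        (ET (Finset.univ \ P₀) * weil P₀ s)) =
      (((Finset.univ \ P₀).card.factorial : ℂ) ^ 2) *
        integral (y * (ET (Finset.univ \ P₀) * weil P₀ s)) := by
  rw [integral_lam_pow_mul, mul_assoc,
    (commute_theta_pow c (Finset.univ \ P₀).card
      (y * (lam c ^ (Finset.univ \ P₀).card) (ET (Finset.univ \ P₀) * weil P₀ s))).eq,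
    mul_assoc, ← (commute_theta_pow c (Finset.univ \ P₀).card
      ((lam c ^ (Finset.univ \ P₀).card) (ET (Finset.univ \ P₀) * weil P₀ s))).eq,
    theta_pow_mul_lam_pow_ET_mul_weil hc, mul_smul_comm, map_smul, smul_eq_mul]

/-- **`Λ^{n−k} L^{n−k}` is the scalar `((n−k)!)²` on the Weil projection** onto a family `W` of
Weil data of common size `k`. -/
theorem weilProjModel_lam_pow_theta_pow_mul {c : ι → ℂ} (hc : ∀ p, c p ≠ 0) {k : ℕ}
    (W : Finset (Finset ι × Bool)) (hW : ∀ d ∈ W, d.1.card = k) (y : A ι) :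
    weilProjModel W ((lam c ^ (Fintype.card ι - k)) (theta c ^ (Fintype.card ι - k) * y)) =
      (((Fintype.card ι - k).factorial : ℂ) ^ 2) • weilProjModel W y := by
  simp only [weilProjModel, Finset.smul_sum, smul_smul]
  refine Finset.sum_congr rfl fun d hd => ?_
  congr 1
  obtain ⟨ε, -, hε⟩ := exists_sign_repr_weilIndex d.1 d.2
  rw [hε, hε, ← card_univ_sdiff_eq d.1 (hW d hd), integral_lam_pow_theta_pow_mul_mul hc]
  ring

/-- **Row 104 from row 109**: for `z ∈ ⋀^{2n−k}`, the Weil projections of `z ⋆ θ^k` and of the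
Lieberman class `y'' = (L^{n−k})⁻¹ z` are proportional, with the constant
`(n−k)!·k!·(∏ c_p)·vol = κ'·((n−k)!)²`. -/
theorem weilProjModel_pontryagin_eq_smul' {c : ι → ℂ} (hc : ∀ p, c p ≠ 0) {k : ℕ}
    (hk : k ≤ Fintype.card ι) {z : A ι} (hz : z ∈ grading ι (2 * Fintype.card ι - k))
    (W : Finset (Finset ι × Bool)) (hW : ∀ d ∈ W, d.1.card = k) :
    weilProjModel W (pontryagin z (theta c ^ k)) =
      ((((Fintype.card ι - k).factorial : ℂ) * (k.factorial : ℂ) * ∏ p, c p) * vol ι) •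
        weilProjModel W (lefschetzInv c hc hk hz) := by
  have hsmul : ∀ (r : ℂ) (x : A ι), weilProjModel W (r • x) = r • weilProjModel W x := by
    intro r x
    simp only [weilProjModel, map_smul, Finsupp.smul_apply, smul_eq_mul, Finset.smul_sum, smul_smul]
  have key : (lam c ^ (Fintype.card ι - k)) z =
      (lam c ^ (Fintype.card ι - k)) (theta c ^ (Fintype.card ι - k) * lefschetzInv c hc hk hz) := by
    rw [theta_pow_mul_lefschetzInv]
  rw [pontryagin_theta_pow_eq_smul_lam_pow hc hk z, hsmul, key,
    weilProjModel_lam_pow_theta_pow_mul hc W hW, smul_smul, kappa']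
  congr 1
  have hfac : ((Fintype.card ι - k).factorial : ℂ) ≠ 0 := by
    exact_mod_cast Nat.factorial_ne_zero _
  field_simp

end Summit.Ventures.HodgeRepro2.A2LefschetzWeilProjection
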